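import Literature.MathematicalPhysics.QuantumFieldTheory.Balaban1983to89.Node00.RateRecordW1MapsAdm
import Literature.MathematicalPhysics.QuantumFieldTheory.Balaban1983to89.Node00.Record12ResidualsBg

/-!
# BalabanUVNodes ∕ node N18 = NE5 — closure-ledger item (iii): THE TWO TRANSPORT CLAUSES OF THE GERM READING AT THE TABLE OF RECORD REDUCE TO ONE
# UNITS-LEVEL TRANSPORT — the background clause `hT₀` of `LevelPairing.ofRecordAdm` and the table clause `hTsp` of W1-14's germ faces both follow from a
# transport of units-valued pairs that (T2) is `Gᶜ`-covariant up to a run-A gauge transformation and (T3) carries [I] (1.11)–(1.16) of run B at level `j+1`,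
# domain `π(j, Y)`, to [I] (1.11)–(1.16) of run A at level `j`, domain `Y`, plus the background face (T1) (Track A, DAG node N18 = `T4OutputRate.NE5` :211; cluster K4
# «SpineRates», item K3⁷ `SpineGivenEndpointR13SepCoPH`; module 21 of seat pub-ymgap-dag-n18-d, strategy s2)

HONEST FRAMING.  Count-neutral kernel bookkeeping (`--supports stmt-QuantumFields-20544 --as helper`); pure logic over r11's `B12RegularSpaces111` (union of
`Gᶜ`-orbits), 11b's `Sect2.spaceI` ∕ `embedPair` and W1's `spaceOfRecord`, PROVED.  (T1)–(T3) are DISPLAYED hypotheses about a transport that this file does NOT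
construct (the intended inhabitant — print's analytic extension of the (0.4) block average to small `Gᶜ`-valued configurations composed with the level
identification — is scale geometry ∕ [Balaban1985Averaging] analysis of another lane); NE5 is NOT PRINTED and NOT proved; N18 is NOT discharged.

WHY.  After W1-14 (`Node00/HistoryGermReading`, p551984) the N18 reading at the table of record `sp k j Y = W1.spaceOfRecord Sg Rz α₀ α₁ j Y = U^c_j(Y, α₀(j), α₁(j))`
carries TWO transport hypotheses: `hT₀` of `RateRecordW1MapsAdm.LevelPairing.ofRecordAdm` (real admissible backgrounds of run B map to real admissible backgrounds of
run A under `T₀`) and `hTsp` of `W1.decayBound_EAgerm_of_sizeAdm` ∕ module 20 (run B's TABLE POINTS at the paired domain map into run A's table under the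
configuration transport `Tcfg`).  `U^c_j` is a union of `Gᶜ`-ORBITS of pairs satisfying (i)–(iv) (`B12RegularSpaces111.space`), read in `Φ` through the injective
`embedPair`; so both clauses follow at once from a transport `TΦ` of units-valued pairs with: (T1) `Tcfg (ιU, 0) = (ι(T₀U), 0)` and `Tcfg ∘ embedPair = embedPair ∘ TΦ`;
(T2) `TΦ (Φ^u) = (TΦ Φ)^{u′}` for `Gᶜ`-valued `u` with some `Gᶜ`-valued `u′` (covariance — [Balaban1985Averaging] (11) for the real average); (T3) `Satisfies_B Φ →
Satisfies_A (TΦ Φ)` ((1.11)–(1.16) at run B's level `j+1` on `π(j, Y)` ⇒ at run A's level `j` on `Y`).  At the residual recipe OF RECORD (the unit recipe,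
`Record12ResidualsBg`: (iv) holds for every configuration) (T3) is a statement about (i)–(iii) only (`Residual.satisfies_frameI_unit_iff`) — whose (1.11) part is
module 13's road, whose (1.12) part is the lens's (β) served by modules 19a ∕ 19b ∕ 19c, and whose (1.13)–(1.14) parts rescale like module 19b §2.  This file pins
that reduction, so that the analysis lane's target is ONE displayed signature: (T3) at the unit recipe.

WHAT.
* §1 `mem_spaceI_image_of_transport` (one table: `ψ ∈ embedPair '' U^c(F_B, c_B, α_B) ⇒ Tcfg ψ ∈ embedPair '' U^c(F_A, c_A, α_A)` from (T1-compat), (T2), (T3)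
  between the two frames).
* §2 ★ `hTsp_spaceOfRecord_of_unitsTransport` (the germ faces' table clause at `W1.spaceOfRecord`, every residual recipe, (T3) with condition (iv)),
  ★ `hTsp_spaceOfRecord_unit_of_unitsTransport` (at the unit recipe: (T3) for (i)–(iii) only).
* §3 ★ `admTransport_of_hTsp` (the background clause `hT₀` from ANY table clause + the background face (T1)), ★ `admTransport_spaceOfRecord_unit_of_unitsTransport`
  (both clauses of the reading of record from (T1)–(T3) at the unit recipe).

WHAT THIS IS NOT.  Not a construction of `TΦ`∕`Tcfg`; not (β); not a discharge; finite tori — not continuum ∕ OS ∕ mass gap ∕ Clay.  0 `def`, 0 `sorry`.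
-/

open Set
open scoped Matrix.Norms.L2Operator

namespace YMDAG.N18.TransportReduction

open Literature.MathematicalPhysics.QuantumFieldTheory.Balaban1983to89
open Literature.MathematicalPhysics.QuantumFieldTheory.Balaban1983to89.T4Continuum
open Literature.MathematicalPhysics.QuantumFieldTheory.Balaban1983to89.B12RegularSpaces111
open Literature.MathematicalPhysics.QuantumFieldTheory.Balaban1983to89.Node00 (MatA ιSU)
open Literature.MathematicalPhysics.QuantumFieldTheory.Balaban1983to89.Node00.Sect2 (domSys domSites CPair ofBackgroundC embedPair spaceI frameI Setting Residual)
open Literature.MathematicalPhysics.QuantumFieldTheory.Balaban1983to89.Node00.W1 (pairOfRecord spaceOfRecord)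

/-! ## §1 One table: membership transports along a covariant, (i)–(iv)-preserving units transport -/

section OneTable

variable {P P' : Params} {𝔸 : Type*} [NormedRing 𝔸] [NormedAlgebra ℂ 𝔸] [CompleteSpace 𝔸]

/-- **MEMBERSHIP IN `U^c` TRANSPORTS** along a configuration transport `Tcfg : Φ_B → Φ_A` that agrees on units-valued pairs with a units transport `TΦ`
(`Tcfg ∘ embedPair = embedPair ∘ TΦ`) which is (T2) covariant — `TΦ (Φ^u) = (TΦ Φ)^{u′}`, `u′` `Gᶜ`-valued when `u` is — and (T3) carries the four conditions of
the source frame to those of the target frame: `ψ ∈ U^c(F_B) ⇒ Tcfg ψ ∈ U^c(F_A)` (the spaces being unions of `Gᶜ`-orbits of pairs satisfying (i)–(iv), read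
through `embedPair`). [cite: Balaban1987RG1, (1.10)-(1.16) p.262; Balaban1985Averaging, (11) p.19] -/
theorem mem_spaceI_image_of_transport {𝓜B 𝓜A : Model 𝔸} {FB : Frame P 0 𝔸} {FA : Frame P' 0 𝔸} {cB cA : StepConsts} {α₀B α₁B γ₀B α₀A α₁A γ₀A : ℝ}
    (Tcfg : CPair P 𝔸 → CPair P' 𝔸) (TΦ : FieldPair P 0 𝔸ˣ 𝔸 → FieldPair P' 0 𝔸ˣ 𝔸)
    (hcompat : ∀ Ψ, Tcfg (embedPair Ψ) = embedPair (TΦ Ψ))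
    (hcov : ∀ (u : Site P 0 → 𝔸ˣ) (Φ : FieldPair P 0 𝔸ˣ 𝔸), (∀ x, u x ∈ 𝓜B.Gc) →
      ∃ u' : Site P' 0 → 𝔸ˣ, (∀ x, u' x ∈ 𝓜A.Gc) ∧ TΦ (act u Φ) = act u' (TΦ Φ))
    (hsat : ∀ Φ, Satisfies 𝓜B FB cB α₀B α₁B γ₀B Φ → Satisfies 𝓜A FA cA α₀A α₁A γ₀A (TΦ Φ))
    {ψ : CPair P 𝔸} (hψ : ψ ∈ embedPair '' space 𝓜B FB cB α₀B α₁B γ₀B) :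
    Tcfg ψ ∈ embedPair '' space 𝓜A FA cA α₀A α₁A γ₀A := by
  obtain ⟨Ψ, ⟨u, Φ₀, hu, hΦ₀, rfl⟩, rfl⟩ := hψ
  obtain ⟨u', hu', hT⟩ := hcov u Φ₀ hu
  refine ⟨TΦ (act u Φ₀), ⟨u', TΦ Φ₀, hu', hsat Φ₀ hΦ₀, hT⟩, (hcompat _).symm⟩

end OneTable

/-! ## §2 At the table of record: the table clause `hTsp` of the germ faces -/

section Record

variable (F : T4Family) (N M : ℕ) (k : ℕ)
variable (SgB : Setting (MatA N) (Node00.SU N)) (SgA : Setting (MatA N) (Node00.SU N))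
  (RzB : Residual (F.P (k + 1)) (MatA N)) (RzA : Residual (F.P k) (MatA N)) (α₀B α₁B α₀A α₁A : ℕ → ℝ)
  (Tcfg : CPair (F.P (k + 1)) (MatA N) → CPair (F.P k) (MatA N))
  (TΦ : FieldPair (F.P (k + 1)) 0 (MatA N)ˣ (MatA N) → FieldPair (F.P k) 0 (MatA N)ˣ (MatA N))

/-- ★ **THE TABLE CLAUSE OF THE GERM FACES AT THE TABLE OF RECORD FROM A UNITS TRANSPORT** (any residual recipes): if `Tcfg` agrees with `TΦ` on units-valued
pairs, `TΦ` is (T2) `Gᶜ`-covariant up to a run-A `Gᶜ`-valued gauge transformation, and (T3) for every run-A domain `(j, Y)` carries [I] (1.11)–(1.16) of run B at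
level `j+1` on the sites of `π(j, Y)` (radii `α₀B (j+1), α₁B (j+1)`) to [I] (1.11)–(1.16) of run A at level `j` on the sites of `Y` (radii `α₀A j, α₁A j`), then run B's
table points at the paired domain map into run A's table: the hypothesis `hTsp` of `W1.decayBound_EAgerm_of_sizeAdm` ∕ module 20 at `sp k := W1.spaceOfRecord …`.
[cite: Balaban1987RG1, (1.10)-(1.16) p.262 and (0.24)-(0.25) p.257; Balaban1985Averaging, (11) p.19] -/
theorem hTsp_spaceOfRecord_of_unitsTransport (hcompat : ∀ Ψ, Tcfg (embedPair Ψ) = embedPair (TΦ Ψ))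
    (hcov : ∀ (u : Site (F.P (k + 1)) 0 → (MatA N)ˣ) (Φ : FieldPair (F.P (k + 1)) 0 (MatA N)ˣ (MatA N)), (∀ x, u x ∈ SgB.𝓜.Gc) →
      ∃ u' : Site (F.P k) 0 → (MatA N)ˣ, (∀ x, u' x ∈ SgA.𝓜.Gc) ∧ TΦ (act u Φ) = act u' (TΦ Φ))
    (hsat : ∀ (j : ℕ) (Y : (domSys (F.P k) M j).Dom) (Φ : FieldPair (F.P (k + 1)) 0 (MatA N)ˣ (MatA N)),
      Satisfies SgB.𝓜 (frameI RzB M (j + 1) (domSites (F.P (k + 1)) M (j + 1) (pairOfRecord F M k ⟨j, Y⟩).2))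
          (StepConsts.ofParams (F.P (k + 1)) SgB.cB (j + 1)) (α₀B (j + 1)) (α₁B (j + 1)) (α₀B (j + 1)) Φ →
        Satisfies SgA.𝓜 (frameI RzA M j (domSites (F.P k) M j Y)) (StepConsts.ofParams (F.P k) SgA.cB j) (α₀A j) (α₁A j) (α₀A j) (TΦ Φ)) :
    ∀ (X : Node00.W1.Dom (F.P k) M) (ψ : CPair (F.P (k + 1)) (MatA N)),
      ψ ∈ spaceOfRecord (M := M) SgB RzB α₀B α₁B (pairOfRecord F M k X).1 (pairOfRecord F M k X).2 →
        Tcfg ψ ∈ spaceOfRecord (M := M) SgA RzA α₀A α₁A X.1 X.2 := by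
  rintro ⟨j, Y⟩ ψ hψ
  exact mem_spaceI_image_of_transport Tcfg TΦ hcompat hcov (hsat j Y) hψ

/-- ★ **THE SAME AT THE RESIDUAL RECIPE OF RECORD (the unit recipe): (T3) FOR CONDITIONS (i)–(iii) ONLY.**  At `Residual.unit` condition (iv) holds for every
configuration (`Record12ResidualsBg.Residual.condIV_unit`), so (T3) is the transport of `SatisfiesI_III` ([I] (1.11)–(1.14)) — (1.11) = module 13's road, (1.12) = the
lens's (β) with modules 19a∕19b∕19c, (1.13)–(1.14) rescale as in module 19b §2 — provided the run-A radii are positive (`0 < α₀A j`). [cite: Balaban1987RG1, (1.11)-(1.16) p.262; Balaban1988Convergent, (2.28) p.259] -/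
theorem hTsp_spaceOfRecord_unit_of_unitsTransport (hcompat : ∀ Ψ, Tcfg (embedPair Ψ) = embedPair (TΦ Ψ))
    (hcov : ∀ (u : Site (F.P (k + 1)) 0 → (MatA N)ˣ) (Φ : FieldPair (F.P (k + 1)) 0 (MatA N)ˣ (MatA N)), (∀ x, u x ∈ SgB.𝓜.Gc) →
      ∃ u' : Site (F.P k) 0 → (MatA N)ˣ, (∀ x, u' x ∈ SgA.𝓜.Gc) ∧ TΦ (act u Φ) = act u' (TΦ Φ))
    (hα : ∀ j, 0 < α₀A j)
    (hsat : ∀ (j : ℕ) (Y : (domSys (F.P k) M j).Dom) (Φ : FieldPair (F.P (k + 1)) 0 (MatA N)ˣ (MatA N)),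
      SatisfiesI_III SgB.𝓜 (frameI (Residual.unit (F.P (k + 1)) (MatA N)) M (j + 1) (domSites (F.P (k + 1)) M (j + 1) (pairOfRecord F M k ⟨j, Y⟩).2))
          (StepConsts.ofParams (F.P (k + 1)) SgB.cB (j + 1)) (α₀B (j + 1)) (α₁B (j + 1)) (α₀B (j + 1)) Φ →
        SatisfiesI_III SgA.𝓜 (frameI (Residual.unit (F.P k) (MatA N)) M j (domSites (F.P k) M j Y)) (StepConsts.ofParams (F.P k) SgA.cB j) (α₀A j) (α₁A j)
          (α₀A j) (TΦ Φ)) :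
    ∀ (X : Node00.W1.Dom (F.P k) M) (ψ : CPair (F.P (k + 1)) (MatA N)),
      ψ ∈ spaceOfRecord (M := M) SgB (Residual.unit (F.P (k + 1)) (MatA N)) α₀B α₁B (pairOfRecord F M k X).1 (pairOfRecord F M k X).2 →
        Tcfg ψ ∈ spaceOfRecord (M := M) SgA (Residual.unit (F.P k) (MatA N)) α₀A α₁A X.1 X.2 := by
  refine hTsp_spaceOfRecord_of_unitsTransport F N M k SgB SgA _ _ α₀B α₁B α₀A α₁A Tcfg TΦ hcompat hcov fun j Y Φ hΦ => ?_
  obtain ⟨hξ, hL⟩ := Node00.Sect2.stepConsts_ofParams_ne_zero (P := F.P k) SgA.cB j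
  exact (Node00.Sect2.Residual.satisfies_frameI_unit_iff SgA.𝓜 M j _ hξ hL (hα j) _).2 (hsat j Y Φ (Satisfies.toI_III _ hΦ))

/-! ## §3 The background clause `hT₀` from the table clause and the background face -/

/-- ★ **THE BACKGROUND CLAUSE FROM ANY TABLE CLAUSE AND THE BACKGROUND FACE (T1)**: if `Tcfg` maps run B's table at every paired domain into run A's table
(`hTsp`, for a table family `sp` indexed by the run length) and reads the background transport on real backgrounds (`Tcfg (ιU, 0) = (ι(T₀ U), 0)`), then `T₀` maps
run B's admissible backgrounds to run A's — the displayed clause `hT₀` of `RateRecordW1MapsAdm.LevelPairing.ofRecordAdm` ∕ `ReadingData.ofRecordAdm` at run length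
`k`. [cite: Balaban1987RG1, (0.21)-(0.22) p.256 and (0.24)-(0.25) p.257] -/
theorem admTransport_of_hTsp (sp : (k j : ℕ) → (domSys (F.P k) M j).Dom → Set (CPair (F.P k) (MatA N)))
    (T₀ : GaugeField (F.P (k + 1)) 0 (Node00.SU N) → GaugeField (F.P k) 0 (Node00.SU N))
    (hface : ∀ U : GaugeField (F.P (k + 1)) 0 (Node00.SU N),
      (∀ (j : ℕ) (Y : (domSys (F.P (k + 1)) M j).Dom), ofBackgroundC (ιSU N) U ∈ sp (k + 1) j Y) →
        Tcfg (ofBackgroundC (ιSU N) U) = ofBackgroundC (ιSU N) (T₀ U))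
    (hTsp : ∀ (X : Node00.W1.Dom (F.P k) M) (ψ : CPair (F.P (k + 1)) (MatA N)),
      ψ ∈ sp (k + 1) (pairOfRecord F M k X).1 (pairOfRecord F M k X).2 → Tcfg ψ ∈ sp k X.1 X.2) :
    ∀ U : GaugeField (F.P (k + 1)) 0 (Node00.SU N),
      (∀ (j : ℕ) (Y : (domSys (F.P (k + 1)) M j).Dom), ofBackgroundC (ιSU N) U ∈ sp (k + 1) j Y) →
        ∀ (j : ℕ) (Y : (domSys (F.P k) M j).Dom), ofBackgroundC (ιSU N) (T₀ U) ∈ sp k j Y := by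
  intro U hU j Y
  rw [← hface U hU]
  exact hTsp ⟨j, Y⟩ _ (hU _ _)

/-- ★ **BOTH TRANSPORT CLAUSES OF THE READING OF RECORD FROM (T1)–(T3) AT THE UNIT RECIPE**: for the table family of record
`sp k j Y := W1.spaceOfRecord (Sg k) (Residual.unit …) (α₀ k) (α₁ k) j Y` (settings and radii indexed by the run), a configuration transport `Tcfg` with a units
transport `TΦ` satisfying (T1) the background face on run B's admissible backgrounds and `Tcfg ∘ embedPair = embedPair ∘ TΦ`, (T2) covariance, (T3) the transport
of (i)–(iii), and positive run-A radii, yields the table clause `hTsp` AND the background clause `hT₀` at run length `k`. [cite: Balaban1987RG1, (0.21)-(0.25) pp.256-257, (1.10)-(1.16) p.262] -/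
theorem admTransport_spaceOfRecord_unit_of_unitsTransport (Sg : ℕ → Setting (MatA N) (Node00.SU N)) (α₀ α₁ : ℕ → ℕ → ℝ)
    (T₀ : GaugeField (F.P (k + 1)) 0 (Node00.SU N) → GaugeField (F.P k) 0 (Node00.SU N))
    (hface : ∀ U : GaugeField (F.P (k + 1)) 0 (Node00.SU N),
      (∀ (j : ℕ) (Y : (domSys (F.P (k + 1)) M j).Dom),
        ofBackgroundC (ιSU N) U ∈ spaceOfRecord (M := M) (Sg (k + 1)) (Residual.unit (F.P (k + 1)) (MatA N)) (α₀ (k + 1)) (α₁ (k + 1)) j Y) →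
        Tcfg (ofBackgroundC (ιSU N) U) = ofBackgroundC (ιSU N) (T₀ U))
    (hcompat : ∀ Ψ, Tcfg (embedPair Ψ) = embedPair (TΦ Ψ))
    (hcov : ∀ (u : Site (F.P (k + 1)) 0 → (MatA N)ˣ) (Φ : FieldPair (F.P (k + 1)) 0 (MatA N)ˣ (MatA N)), (∀ x, u x ∈ (Sg (k + 1)).𝓜.Gc) →
      ∃ u' : Site (F.P k) 0 → (MatA N)ˣ, (∀ x, u' x ∈ (Sg k).𝓜.Gc) ∧ TΦ (act u Φ) = act u' (TΦ Φ))
    (hα : ∀ j, 0 < α₀ k j)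
    (hsat : ∀ (j : ℕ) (Y : (domSys (F.P k) M j).Dom) (Φ : FieldPair (F.P (k + 1)) 0 (MatA N)ˣ (MatA N)),
      SatisfiesI_III (Sg (k + 1)).𝓜 (frameI (Residual.unit (F.P (k + 1)) (MatA N)) M (j + 1) (domSites (F.P (k + 1)) M (j + 1) (pairOfRecord F M k ⟨j, Y⟩).2))
          (StepConsts.ofParams (F.P (k + 1)) (Sg (k + 1)).cB (j + 1)) (α₀ (k + 1) (j + 1)) (α₁ (k + 1) (j + 1)) (α₀ (k + 1) (j + 1)) Φ →
        SatisfiesI_III (Sg k).𝓜 (frameI (Residual.unit (F.P k) (MatA N)) M j (domSites (F.P k) M j Y)) (StepConsts.ofParams (F.P k) (Sg k).cB j) (α₀ k j)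
          (α₁ k j) (α₀ k j) (TΦ Φ)) :
    (∀ (X : Node00.W1.Dom (F.P k) M) (ψ : CPair (F.P (k + 1)) (MatA N)),
        ψ ∈ spaceOfRecord (M := M) (Sg (k + 1)) (Residual.unit (F.P (k + 1)) (MatA N)) (α₀ (k + 1)) (α₁ (k + 1)) (pairOfRecord F M k X).1
            (pairOfRecord F M k X).2 →
          Tcfg ψ ∈ spaceOfRecord (M := M) (Sg k) (Residual.unit (F.P k) (MatA N)) (α₀ k) (α₁ k) X.1 X.2) ∧
      ∀ U : GaugeField (F.P (k + 1)) 0 (Node00.SU N),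
        (∀ (j : ℕ) (Y : (domSys (F.P (k + 1)) M j).Dom),
            ofBackgroundC (ιSU N) U ∈ spaceOfRecord (M := M) (Sg (k + 1)) (Residual.unit (F.P (k + 1)) (MatA N)) (α₀ (k + 1)) (α₁ (k + 1)) j Y) →
          ∀ (j : ℕ) (Y : (domSys (F.P k) M j).Dom),
            ofBackgroundC (ιSU N) (T₀ U) ∈ spaceOfRecord (M := M) (Sg k) (Residual.unit (F.P k) (MatA N)) (α₀ k) (α₁ k) j Y := by
  have hTsp := hTsp_spaceOfRecord_unit_of_unitsTransport F N M k (Sg (k + 1)) (Sg k) (α₀ (k + 1)) (α₁ (k + 1)) (α₀ k) (α₁ k) Tcfg TΦ hcompat hcov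
    hα hsat
  exact ⟨hTsp, admTransport_of_hTsp F N M k Tcfg (fun k j Y => spaceOfRecord (M := M) (Sg k) (Residual.unit (F.P k) (MatA N)) (α₀ k) (α₁ k) j Y)
    T₀ hface hTsp⟩

end Record

/-! ## §4 (v1.1) THE ORBIT FORM OF (T3) — the transported pair need only be `Gᶜ`-GAUGE-EQUIVALENT to a pair satisfying run A's conditions

LENS NOTE (ym-lens-transfer g30, bus 2026-08-27 [LENS-TRANSFER-G30-0] (2)): for the (1.13)∕(ii) half the first-order part of the transported potential carries the
comb term `−(iξ_A)⁻¹·dλ̄`, whose coarse `∇`-letter is a second difference that (1.13) does not control, so `hsat` AS DISPLAYED in §1–§3 (`Satisfies … (TΦ Φ)` on the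
nose) is not inhabitable by any radii family; print's `U^c_j` is a union of `Gᶜ`-ORBITS ([I] p.262, `B12RegularSpaces111.space`), and the complex comb gauge
`w = exp(−λ̄)` re-factorises the acted pair with the comb term removed.  The located edition: weaken (T3) to the ORBIT form `Satisfies_B Φ → ∃ w (Gᶜ-valued),
Satisfies_A (act w (TΦ Φ))`; §1–§3 go through with representative `act w (TΦ Φ₀)` and gauge `u′·w⁻¹` (`act_mul`, `act_inv_act`, `Gc.mul_mem ∕ inv_mem`). -/

section Orbit

variable {P P' : Params} {𝔸 : Type*} [NormedRing 𝔸] [NormedAlgebra ℂ 𝔸] [CompleteSpace 𝔸]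

/-- ★ **§1 IN ORBIT FORM**: as `mem_spaceI_image_of_transport`, with (T3) weakened to «the transported pair is `Gᶜ`-gauge-equivalent to a pair satisfying the target
conditions» — `(act u Φ₀) ↦ act u′ (TΦ Φ₀) = act (u′·w⁻¹) (act w (TΦ Φ₀))`. [cite: Balaban1987RG1, (1.10)-(1.16) p.262] -/
theorem mem_spaceI_image_of_transport_orbit {𝓜B 𝓜A : Model 𝔸} {FB : Frame P 0 𝔸} {FA : Frame P' 0 𝔸} {cB cA : StepConsts} {α₀B α₁B γ₀B α₀A α₁A γ₀A : ℝ}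
    (Tcfg : CPair P 𝔸 → CPair P' 𝔸) (TΦ : FieldPair P 0 𝔸ˣ 𝔸 → FieldPair P' 0 𝔸ˣ 𝔸)
    (hcompat : ∀ Ψ, Tcfg (embedPair Ψ) = embedPair (TΦ Ψ))
    (hcov : ∀ (u : Site P 0 → 𝔸ˣ) (Φ : FieldPair P 0 𝔸ˣ 𝔸), (∀ x, u x ∈ 𝓜B.Gc) →
      ∃ u' : Site P' 0 → 𝔸ˣ, (∀ x, u' x ∈ 𝓜A.Gc) ∧ TΦ (act u Φ) = act u' (TΦ Φ))
    (hsat : ∀ Φ, Satisfies 𝓜B FB cB α₀B α₁B γ₀B Φ →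
      ∃ w : Site P' 0 → 𝔸ˣ, (∀ x, w x ∈ 𝓜A.Gc) ∧ Satisfies 𝓜A FA cA α₀A α₁A γ₀A (act w (TΦ Φ)))
    {ψ : CPair P 𝔸} (hψ : ψ ∈ embedPair '' space 𝓜B FB cB α₀B α₁B γ₀B) :
    Tcfg ψ ∈ embedPair '' space 𝓜A FA cA α₀A α₁A γ₀A := by
  obtain ⟨Ψ, ⟨u, Φ₀, hu, hΦ₀, rfl⟩, rfl⟩ := hψ
  obtain ⟨u', hu', hT⟩ := hcov u Φ₀ hu
  obtain ⟨w, hw, hsw⟩ := hsat Φ₀ hΦ₀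
  refine ⟨TΦ (act u Φ₀), ⟨u' * w⁻¹, act w (TΦ Φ₀), fun x => 𝓜A.Gc.mul_mem (hu' x) (𝓜A.Gc.inv_mem (hw x)), hsw, ?_⟩, (hcompat _).symm⟩
  rw [hT, act_mul, act_inv_act]

end Orbit

section RecordOrbit

variable (F : T4Family) (N M : ℕ) (k : ℕ)
variable (SgB : Setting (MatA N) (Node00.SU N)) (SgA : Setting (MatA N) (Node00.SU N))
  (RzB : Residual (F.P (k + 1)) (MatA N)) (RzA : Residual (F.P k) (MatA N)) (α₀B α₁B α₀A α₁A : ℕ → ℝ)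
  (Tcfg : CPair (F.P (k + 1)) (MatA N) → CPair (F.P k) (MatA N))
  (TΦ : FieldPair (F.P (k + 1)) 0 (MatA N)ˣ (MatA N) → FieldPair (F.P k) 0 (MatA N)ˣ (MatA N))

/-- ★ **§2 IN ORBIT FORM** (any residual recipes): the table clause `hTsp` at the table of record from (T1)-compatibility, (T2) covariance and (T3) in orbit form.
[cite: Balaban1987RG1, (1.10)-(1.16) p.262 and (0.24)-(0.25) p.257] -/
theorem hTsp_spaceOfRecord_of_unitsTransport_orbit (hcompat : ∀ Ψ, Tcfg (embedPair Ψ) = embedPair (TΦ Ψ))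
    (hcov : ∀ (u : Site (F.P (k + 1)) 0 → (MatA N)ˣ) (Φ : FieldPair (F.P (k + 1)) 0 (MatA N)ˣ (MatA N)), (∀ x, u x ∈ SgB.𝓜.Gc) →
      ∃ u' : Site (F.P k) 0 → (MatA N)ˣ, (∀ x, u' x ∈ SgA.𝓜.Gc) ∧ TΦ (act u Φ) = act u' (TΦ Φ))
    (hsat : ∀ (j : ℕ) (Y : (domSys (F.P k) M j).Dom) (Φ : FieldPair (F.P (k + 1)) 0 (MatA N)ˣ (MatA N)),
      Satisfies SgB.𝓜 (frameI RzB M (j + 1) (domSites (F.P (k + 1)) M (j + 1) (pairOfRecord F M k ⟨j, Y⟩).2))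
          (StepConsts.ofParams (F.P (k + 1)) SgB.cB (j + 1)) (α₀B (j + 1)) (α₁B (j + 1)) (α₀B (j + 1)) Φ →
        ∃ w : Site (F.P k) 0 → (MatA N)ˣ, (∀ x, w x ∈ SgA.𝓜.Gc) ∧
          Satisfies SgA.𝓜 (frameI RzA M j (domSites (F.P k) M j Y)) (StepConsts.ofParams (F.P k) SgA.cB j) (α₀A j) (α₁A j) (α₀A j) (act w (TΦ Φ))) :
    ∀ (X : Node00.W1.Dom (F.P k) M) (ψ : CPair (F.P (k + 1)) (MatA N)),
      ψ ∈ spaceOfRecord (M := M) SgB RzB α₀B α₁B (pairOfRecord F M k X).1 (pairOfRecord F M k X).2 →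
        Tcfg ψ ∈ spaceOfRecord (M := M) SgA RzA α₀A α₁A X.1 X.2 := by
  rintro ⟨j, Y⟩ ψ hψ
  exact mem_spaceI_image_of_transport_orbit Tcfg TΦ hcompat hcov (hsat j Y) hψ

/-- ★ **THE UNIT RECIPE IN ORBIT FORM**: (T3) = «`SatisfiesI_III` of run B at level `j+1` ⟹ some `Gᶜ`-gauge transform of the transported pair satisfies
`SatisfiesI_III` of run A at level `j`», positive run-A radii. [cite: Balaban1987RG1, (1.11)-(1.16) p.262; Balaban1988Convergent, (2.28) p.259] -/
theorem hTsp_spaceOfRecord_unit_of_unitsTransport_orbit (hcompat : ∀ Ψ, Tcfg (embedPair Ψ) = embedPair (TΦ Ψ))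
    (hcov : ∀ (u : Site (F.P (k + 1)) 0 → (MatA N)ˣ) (Φ : FieldPair (F.P (k + 1)) 0 (MatA N)ˣ (MatA N)), (∀ x, u x ∈ SgB.𝓜.Gc) →
      ∃ u' : Site (F.P k) 0 → (MatA N)ˣ, (∀ x, u' x ∈ SgA.𝓜.Gc) ∧ TΦ (act u Φ) = act u' (TΦ Φ))
    (hα : ∀ j, 0 < α₀A j)
    (hsat : ∀ (j : ℕ) (Y : (domSys (F.P k) M j).Dom) (Φ : FieldPair (F.P (k + 1)) 0 (MatA N)ˣ (MatA N)),
      SatisfiesI_III SgB.𝓜 (frameI (Residual.unit (F.P (k + 1)) (MatA N)) M (j + 1) (domSites (F.P (k + 1)) M (j + 1) (pairOfRecord F M k ⟨j, Y⟩).2))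
          (StepConsts.ofParams (F.P (k + 1)) SgB.cB (j + 1)) (α₀B (j + 1)) (α₁B (j + 1)) (α₀B (j + 1)) Φ →
        ∃ w : Site (F.P k) 0 → (MatA N)ˣ, (∀ x, w x ∈ SgA.𝓜.Gc) ∧
          SatisfiesI_III SgA.𝓜 (frameI (Residual.unit (F.P k) (MatA N)) M j (domSites (F.P k) M j Y)) (StepConsts.ofParams (F.P k) SgA.cB j) (α₀A j) (α₁A j)
            (α₀A j) (act w (TΦ Φ))) :
    ∀ (X : Node00.W1.Dom (F.P k) M) (ψ : CPair (F.P (k + 1)) (MatA N)),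
      ψ ∈ spaceOfRecord (M := M) SgB (Residual.unit (F.P (k + 1)) (MatA N)) α₀B α₁B (pairOfRecord F M k X).1 (pairOfRecord F M k X).2 →
        Tcfg ψ ∈ spaceOfRecord (M := M) SgA (Residual.unit (F.P k) (MatA N)) α₀A α₁A X.1 X.2 := by
  refine hTsp_spaceOfRecord_of_unitsTransport_orbit F N M k SgB SgA _ _ α₀B α₁B α₀A α₁A Tcfg TΦ hcompat hcov fun j Y Φ hΦ => ?_
  obtain ⟨hξ, hL⟩ := Node00.Sect2.stepConsts_ofParams_ne_zero (P := F.P k) SgA.cB j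
  obtain ⟨w, hw, hs⟩ := hsat j Y Φ (Satisfies.toI_III _ hΦ)
  exact ⟨w, hw, (Node00.Sect2.Residual.satisfies_frameI_unit_iff SgA.𝓜 M j _ hξ hL (hα j) _).2 hs⟩

/-- ★ **BOTH TRANSPORT CLAUSES FROM (T1), (T2) AND (T3) IN ORBIT FORM AT THE UNIT RECIPE** (the edition of `admTransport_spaceOfRecord_unit_of_unitsTransport` the
(1.13) half needs). [cite: Balaban1987RG1, (0.21)-(0.25) pp.256-257, (1.10)-(1.16) p.262] -/
theorem admTransport_spaceOfRecord_unit_of_unitsTransport_orbit (Sg : ℕ → Setting (MatA N) (Node00.SU N)) (α₀ α₁ : ℕ → ℕ → ℝ)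
    (T₀ : GaugeField (F.P (k + 1)) 0 (Node00.SU N) → GaugeField (F.P k) 0 (Node00.SU N))
    (hface : ∀ U : GaugeField (F.P (k + 1)) 0 (Node00.SU N),
      (∀ (j : ℕ) (Y : (domSys (F.P (k + 1)) M j).Dom),
        ofBackgroundC (ιSU N) U ∈ spaceOfRecord (M := M) (Sg (k + 1)) (Residual.unit (F.P (k + 1)) (MatA N)) (α₀ (k + 1)) (α₁ (k + 1)) j Y) →
        Tcfg (ofBackgroundC (ιSU N) U) = ofBackgroundC (ιSU N) (T₀ U))
    (hcompat : ∀ Ψ, Tcfg (embedPair Ψ) = embedPair (TΦ Ψ))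
    (hcov : ∀ (u : Site (F.P (k + 1)) 0 → (MatA N)ˣ) (Φ : FieldPair (F.P (k + 1)) 0 (MatA N)ˣ (MatA N)), (∀ x, u x ∈ (Sg (k + 1)).𝓜.Gc) →
      ∃ u' : Site (F.P k) 0 → (MatA N)ˣ, (∀ x, u' x ∈ (Sg k).𝓜.Gc) ∧ TΦ (act u Φ) = act u' (TΦ Φ))
    (hα : ∀ j, 0 < α₀ k j)
    (hsat : ∀ (j : ℕ) (Y : (domSys (F.P k) M j).Dom) (Φ : FieldPair (F.P (k + 1)) 0 (MatA N)ˣ (MatA N)),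
      SatisfiesI_III (Sg (k + 1)).𝓜 (frameI (Residual.unit (F.P (k + 1)) (MatA N)) M (j + 1) (domSites (F.P (k + 1)) M (j + 1) (pairOfRecord F M k ⟨j, Y⟩).2))
          (StepConsts.ofParams (F.P (k + 1)) (Sg (k + 1)).cB (j + 1)) (α₀ (k + 1) (j + 1)) (α₁ (k + 1) (j + 1)) (α₀ (k + 1) (j + 1)) Φ →
        ∃ w : Site (F.P k) 0 → (MatA N)ˣ, (∀ x, w x ∈ (Sg k).𝓜.Gc) ∧
          SatisfiesI_III (Sg k).𝓜 (frameI (Residual.unit (F.P k) (MatA N)) M j (domSites (F.P k) M j Y)) (StepConsts.ofParams (F.P k) (Sg k).cB j) (α₀ k j)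
            (α₁ k j) (α₀ k j) (act w (TΦ Φ))) :
    (∀ (X : Node00.W1.Dom (F.P k) M) (ψ : CPair (F.P (k + 1)) (MatA N)),
        ψ ∈ spaceOfRecord (M := M) (Sg (k + 1)) (Residual.unit (F.P (k + 1)) (MatA N)) (α₀ (k + 1)) (α₁ (k + 1)) (pairOfRecord F M k X).1
            (pairOfRecord F M k X).2 →
          Tcfg ψ ∈ spaceOfRecord (M := M) (Sg k) (Residual.unit (F.P k) (MatA N)) (α₀ k) (α₁ k) X.1 X.2) ∧
      ∀ U : GaugeField (F.P (k + 1)) 0 (Node00.SU N),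
        (∀ (j : ℕ) (Y : (domSys (F.P (k + 1)) M j).Dom),
            ofBackgroundC (ιSU N) U ∈ spaceOfRecord (M := M) (Sg (k + 1)) (Residual.unit (F.P (k + 1)) (MatA N)) (α₀ (k + 1)) (α₁ (k + 1)) j Y) →
          ∀ (j : ℕ) (Y : (domSys (F.P k) M j).Dom),
            ofBackgroundC (ιSU N) (T₀ U) ∈ spaceOfRecord (M := M) (Sg k) (Residual.unit (F.P k) (MatA N)) (α₀ k) (α₁ k) j Y := by
  have hTsp := hTsp_spaceOfRecord_unit_of_unitsTransport_orbit F N M k (Sg (k + 1)) (Sg k) (α₀ (k + 1)) (α₁ (k + 1)) (α₀ k) (α₁ k) Tcfg TΦ hcompat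
    hcov hα hsat
  exact ⟨hTsp, admTransport_of_hTsp F N M k Tcfg (fun k j Y => spaceOfRecord (M := M) (Sg k) (Residual.unit (F.P k) (MatA N)) (α₀ k) (α₁ k) j Y)
    T₀ hface hTsp⟩

end RecordOrbit

end YMDAG.N18.TransportReduction
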